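import Summits.ABC.StewartYu.PadicG3PackClosedP
import Summits.ABC.StewartYu.PadicG3TwoLogForm
import HarnessLib

/-!
# Cell abc-stewartyu, crux `Y07Odd` (stmt-ABC-19658), line `gen3-slab-odd`: the record's step inequalities FROM LOGARITHMIC LINES —
# generic reduction (any odd `p`, any schedule): the `‖Λ‖`-branch is below the gain branch under ONE smallness exponent, and the gain
# branch follows from `log BwP + log K < zeros · log ρ`

`Summits/ABC/StewartYu/PadicG3OddLogForm.lean` — cell `abc-stewartyu` (HOME `run/shared/lean/pub/abc-stewartyu/`), seat p5 (g4); the odd-`p`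
twin of p3's `PadicG3TwoLogForm` / `PadicG3TwoFirstBranch` (there `ρ = 4·2^m`; here `ρ = p^m·√p`, `log ρ = (m + ½)·log p = G` at `θ₀ = ½`).
Theorems only (real arithmetic); no named fact; no schedule, no parameters.

* `log_rho` (`log(p^m √p) = (m+½) log p`), `log_BwP` (`log BwP = ⌊L₀/(p−1)⌋·log p + L₀·(m+½)·log p`), `sqrt_pow_le` (`√p^g ≤ p^{⌈g/2⌉}`),
  `rho_pow_le` (`ρ^g ≤ p^{m g + ⌈g/2⌉}`);
* **`first_le_gain_odd`** — with `‖Λ/b_{j₀}‖ ≤ p^{−E}` and `⌊(t−1)/2⌋ + c + m·g + ⌈g/2⌉ ≤ E` the comparison branch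
  `Bw·‖Λ/b_{j₀}‖·p^{⌊(t−1)/2⌋}·p^{c}` is `≤ Bw/ρ^g` (so every step needs only its gain branch and ONE exponent);
* (the gain branch `log Bw + log K < g·log ρ ⇒ Bw/ρ^g < 1/K` is p3's `TwoSetup.branch_gain_lt_of_log`, reused), **`gain_lt_threshold_of_log`** (the half-step threshold
  `D/(4D²(1+Q)P³)^{2^{n+1}}` from `log Bw + 2^{n+1}·(log 4 + 2 log D + log(1+Q) + 3 log P) − log D < g·log ρ`);
* **`kstep_max_lt_of_lines`**, **`half_max_lt_of_lines`** — the `max (Λ-branch) (gain branch) < …` shapes of `KStepHypU` / `HalfStepHypU` /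
  `IneqPackR₂` from the two lines.

WHAT THIS IS NOT: no size bounds of `KC`, `DCs`, `MhCs` (sequel `PadicG3OddLines`); no numbers; no crux moves.

References: Yu. V. Nesterenko, LNM 1819 (2003) §4.2 (4.29)–(4.33), §4.3; K. Yu, Acta Math. 211 (2013) Lemma 5.2 (5.28)–(5.31).
-/

noncomputable section

open Finset Real
open Literature.NumberTheory.Transcendental

namespace Summit.ABC.StewartYu

namespace G3OddLog

/-! ### The radius `ρ = p^m √p` -/

/-- `log (p^m · √p) = (m + ½)·log p` for `p > 0`. [folklore] -/
theorem log_rho {p : ℝ} (hp : 0 < p) (m : ℕ) : Real.log (p ^ m * Real.sqrt p) = ((m : ℝ) + 1 / 2) * Real.log p := by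
  rw [Real.log_mul (by positivity) (Real.sqrt_pos.mpr hp).ne', Real.log_pow, Real.log_sqrt hp.le]
  ring

/-- `√p ^ g ≤ p ^ ⌈g/2⌉` (`= p^{(g+1)/2}` in natural division) for `p ≥ 1`. [folklore] -/
theorem sqrt_pow_le {p : ℝ} (hp : 1 ≤ p) (g : ℕ) : Real.sqrt p ^ g ≤ p ^ ((g + 1) / 2) := by
  have hp0 : 0 ≤ p := le_trans zero_le_one hp
  have hsq : Real.sqrt p ^ 2 = p := Real.sq_sqrt hp0
  rcases Nat.even_or_odd g with ⟨k, hk⟩ | ⟨k, hk⟩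
  · subst hk
    rw [show k + k = 2 * k by ring, pow_mul, hsq, show (2 * k + 1) / 2 = k by omega]
  · subst hk
    rw [show (2 * k + 1 + 1) / 2 = k + 1 by omega, pow_succ, pow_mul, hsq, pow_succ]
    refine mul_le_mul_of_nonneg_left ?_ (by positivity)
    calc Real.sqrt p ≤ Real.sqrt p * Real.sqrt p := le_mul_of_one_le_right (Real.sqrt_nonneg _) (by rw [Real.one_le_sqrt]; exact hp)
      _ = p := Real.mul_self_sqrt hp0

/-- `(p^m √p)^g ≤ p^{m·g + ⌈g/2⌉}` for `p ≥ 1`. [folklore] -/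
theorem rho_pow_le {p : ℝ} (hp : 1 ≤ p) (m g : ℕ) : (p ^ m * Real.sqrt p) ^ g ≤ p ^ (m * g + (g + 1) / 2) := by
  rw [mul_pow, ← pow_mul, pow_add]
  exact mul_le_mul_of_nonneg_left (sqrt_pow_le hp g) (by positivity)

/-- **`log BwP = ⌊L₀/(p−1)⌋·log p + L₀·(m+½)·log p`.** [cite: Nesterenko2003, (3.8); shape only] -/
theorem log_BwP {p : ℕ} [Fact p.Prime] (L₀ m : ℕ) :
    Real.log (G3Setup.BwP (p := p) L₀ m) = ((L₀ / (p - 1) : ℕ) : ℝ) * Real.log p + L₀ * (((m : ℝ) + 1 / 2) * Real.log p) := by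
  have hp : (0 : ℝ) < p := by exact_mod_cast (Fact.out : p.Prime).pos
  unfold G3Setup.BwP
  rw [Real.log_mul (by positivity) (by positivity), Real.log_pow, Real.log_pow, log_rho hp m]

/-! ### The comparison branch is below the gain branch -/

/-- **The `‖Λ‖`-branch is dominated by the gain branch** when `‖Λ/b_{j₀}‖ ≤ p^{−E}` with `⌊(t−1)/2⌋ + c + m·g + ⌈g/2⌉ ≤ E`:
`Bw·Λ·p^{⌊(t−1)/2⌋}·p^{c} ≤ Bw/(p^m√p)^g`. [cite: Yu2013, Lemma 5.1; shape only] -/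
theorem first_le_gain_odd {p : ℝ} (hp : 1 ≤ p) {Bw Λ : ℝ} (hBw : 0 ≤ Bw) {m t c g E : ℕ}
    (hΛ : Λ ≤ (p ^ E)⁻¹) (hE : (t - 1) / 2 + c + m * g + (g + 1) / 2 ≤ E) :
    Bw * Λ * p ^ ((t - 1) / 2) * p ^ c ≤ Bw / (p ^ m * Real.sqrt p) ^ g := by
  have hp0 : 0 < p := lt_of_lt_of_le zero_lt_one hp
  have hρ : 0 < (p ^ m * Real.sqrt p) ^ g := by positivity
  rw [le_div_iff₀ hρ]
  -- `Λ · p^a · p^c · ρ^g ≤ p^{−E} · p^{a+c+mg+⌈g/2⌉} ≤ 1`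
  have hρle := rho_pow_le hp m g
  have key : Λ * (p ^ ((t - 1) / 2) * p ^ c * (p ^ m * Real.sqrt p) ^ g) ≤ 1 := by
    calc Λ * (p ^ ((t - 1) / 2) * p ^ c * (p ^ m * Real.sqrt p) ^ g)
        ≤ (p ^ E)⁻¹ * (p ^ ((t - 1) / 2) * p ^ c * p ^ (m * g + (g + 1) / 2)) := by
          refine mul_le_mul hΛ (mul_le_mul_of_nonneg_left hρle (by positivity)) (by positivity) (by positivity)
      _ = (p ^ E)⁻¹ * p ^ ((t - 1) / 2 + c + (m * g + (g + 1) / 2)) := by rw [pow_add, pow_add, pow_add]; ring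
      _ ≤ (p ^ E)⁻¹ * p ^ E := by
          refine mul_le_mul_of_nonneg_left (pow_le_pow_right₀ hp (by omega)) (by positivity)
      _ = 1 := inv_mul_cancel₀ (by positivity)
  calc Bw * Λ * p ^ ((t - 1) / 2) * p ^ c * (p ^ m * Real.sqrt p) ^ g
      = Bw * (Λ * (p ^ ((t - 1) / 2) * p ^ c * (p ^ m * Real.sqrt p) ^ g)) := by ring
    _ ≤ Bw * 1 := mul_le_mul_of_nonneg_left key hBw
    _ = Bw := mul_one _

/-- Smallness is monotone in the exponent: `‖Λ‖ ≤ p^{−U}` and `E ≤ U` give `‖Λ‖ ≤ p^{−E}` (`p ≥ 1`). [folklore] -/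
theorem le_inv_pow_of_le {p : ℝ} (hp : 1 ≤ p) {Λ : ℝ} {U E : ℕ} (hE : E ≤ U) (hΛ : Λ ≤ (p ^ U)⁻¹) : Λ ≤ (p ^ E)⁻¹ :=
  hΛ.trans (inv_anti₀ (by have := lt_of_lt_of_le zero_lt_one hp; positivity) (pow_le_pow_right₀ hp hE))

/-! ### The gain branch from a logarithmic line -/

/-- **The half-step threshold from a logarithmic line**: with `D ≥ 1`, `Q ≥ 0`, `P ≥ 1`,
`log Bw + e·(log 4 + 2·log D + log(1+Q) + 3·log P) − log D < g·log ρ ⇒ Bw/ρ^g < D/(4·D²·(1+Q)·P³)^e`.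
[cite: Nesterenko2003, §4.3 (4.44); shape only] -/
theorem gain_lt_threshold_of_log {Bw D Q P ρ : ℝ} {g e : ℕ} (hBw : 0 < Bw) (hD : 1 ≤ D) (hQ : 0 ≤ Q) (hP : 1 ≤ P) (hρ : 0 < ρ)
    (hlog : Real.log Bw + e * (Real.log 4 + 2 * Real.log D + Real.log (1 + Q) + 3 * Real.log P) - Real.log D < g * Real.log ρ) :
    Bw / ρ ^ g < D / (4 * D ^ 2 * (1 + Q) * P ^ 3) ^ e := by
  have hD0 : 0 < D := lt_of_lt_of_le zero_lt_one hD
  have hP0 : 0 < P := lt_of_lt_of_le zero_lt_one hP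
  have hbase : 0 < 4 * D ^ 2 * (1 + Q) * P ^ 3 := by positivity
  have hρg : 0 < ρ ^ g := pow_pos hρ g
  rw [div_lt_div_iff₀ hρg (pow_pos hbase e)]
  have hl : 0 < Bw * (4 * D ^ 2 * (1 + Q) * P ^ 3) ^ e := by positivity
  have hr : 0 < D * ρ ^ g := by positivity
  rw [← Real.log_lt_log_iff hl hr, Real.log_mul hBw.ne' (pow_pos hbase e).ne', Real.log_pow, Real.log_mul hD0.ne' hρg.ne', Real.log_pow,
    Real.log_mul (by positivity) (by positivity), Real.log_mul (by positivity) (by positivity : (1 + Q) ≠ 0),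
    Real.log_mul (by norm_num) (by positivity), Real.log_pow, Real.log_pow]
  push_cast
  linarith

/-! ### The `max`-shapes of the packages from the two lines -/

/-- **A k-step inequality (both branches) from its lines**: smallness `‖Λ/b_{j₀}‖ ≤ p^{−E}` with the exponent line
`⌊(t−1)/2⌋ + c + m·g + ⌈g/2⌉ ≤ E`, and the gain line `log Bw + log K < g·(m+½)·log p` give
`max (Bw·‖Λ/b_{j₀}‖·p^{⌊(t−1)/2⌋}·p^c) (Bw/(p^m√p)^g) < 1/K`. [cite: Nesterenko2003, §4.2 (4.29)–(4.33); shape only] -/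
theorem kstep_max_lt_of_lines {p : ℝ} (hp : 1 < p) {Bw Λ K : ℝ} (hBw : 0 < Bw) (hK : 0 < K) {m t c g E : ℕ}
    (hΛ : Λ ≤ (p ^ E)⁻¹) (hE : (t - 1) / 2 + c + m * g + (g + 1) / 2 ≤ E)
    (hgain : Real.log Bw + Real.log K < g * (((m : ℝ) + 1 / 2) * Real.log p)) :
    max (Bw * Λ * p ^ ((t - 1) / 2) * p ^ c) (Bw / (p ^ m * Real.sqrt p) ^ g) < 1 / K := by
  have hp0 : 0 < p := lt_trans zero_lt_one hp
  have hρ : 0 < p ^ m * Real.sqrt p := by positivity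
  have hB : Bw / (p ^ m * Real.sqrt p) ^ g < 1 / K := by
    refine TwoSetup.branch_gain_lt_of_log hBw hK hρ ?_
    rwa [log_rho hp0 m]
  exact max_lt (lt_of_le_of_lt (first_le_gain_odd hp.le hBw.le hΛ hE) hB) hB

/-- **A half-step inequality (both branches) from its lines**: smallness + exponent line as for a k-step, and the gain line
`log Bw + 2^{n+1}·(log 4 + 2 log D + log(1+Q) + 3 log P) − log D < g·(m+½)·log p` give
`max (Bw·‖Λ/b_{j₀}‖·p^{⌊(t−1)/2⌋}·p^c) (Bw/(p^m√p)^g) < D/(4D²(1+Q)P³)^{2^{n+1}}`. [cite: Nesterenko2003, §4.3 (4.44); shape only] -/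
theorem half_max_lt_of_lines {p : ℝ} (hp : 1 < p) {Bw Λ D Q P : ℝ} (hBw : 0 < Bw) (hD : 1 ≤ D) (hQ : 0 ≤ Q) (hP : 1 ≤ P)
    {m t c g E e : ℕ} (hΛ : Λ ≤ (p ^ E)⁻¹) (hE : (t - 1) / 2 + c + m * g + (g + 1) / 2 ≤ E)
    (hgain : Real.log Bw + e * (Real.log 4 + 2 * Real.log D + Real.log (1 + Q) + 3 * Real.log P) - Real.log D <
      g * (((m : ℝ) + 1 / 2) * Real.log p)) :
    max (Bw * Λ * p ^ ((t - 1) / 2) * p ^ c) (Bw / (p ^ m * Real.sqrt p) ^ g) < D / (4 * D ^ 2 * (1 + Q) * P ^ 3) ^ e := by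
  have hp0 : 0 < p := lt_trans zero_lt_one hp
  have hρ : 0 < p ^ m * Real.sqrt p := by positivity
  have hB : Bw / (p ^ m * Real.sqrt p) ^ g < D / (4 * D ^ 2 * (1 + Q) * P ^ 3) ^ e := by
    refine gain_lt_threshold_of_log hBw hD hQ hP hρ ?_
    rwa [log_rho hp0 m]
  exact max_lt (lt_of_le_of_lt (first_le_gain_odd hp.le hBw.le hΛ hE) hB) hB

end G3OddLog

end Summit.ABC.StewartYu

end
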